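import Summits.QuantumFields.BalabanUV.T4Continuum.Support.NE7MinActC2Lift
import Summits.QuantumFields.BalabanUV.T4Continuum.Support.NE7FibreStraightening
import HarnessLib

/-!
# NE7MinActMultiplier — THE LAGRANGE MULTIPLIER OF THE CONSTRAINED MINIMISER IS THE DERIVATIVE OF THE MINIMAL ACTION: `w·D𝒜(0)[Z] = Dm(0)[Q′Z]` for every fine direction `Z`
# (first-order envelope identity at EVERY small datum, ROAD-G115 §5 (iii); the input of the bordered Hessian)

Around a minimiser `U♯` over a small unitary `N`-periodic datum `V₀` satisfying the lift hypothesis (G3′) (✓ p824904 proves it everywhere): with `𝒜(Φ) = fineAction(chart_{U♯} Φ)` on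
`skewSub M`, `m(y) = minAct(chart_{V₀} y)` on `skewSub N`, `Q′ = levelQ′ L N j U♯` the linearised `(j+1)`-fold averaging map and `w = stepWt⁻ʲ⁻¹`: (i) `D𝒜(0)` VANISHES on `ker Q′`
(tangent-criticality of the minimiser along the fibre, here from the fibre straightening ✓ p821389: `chart θ(0, tZ)` stays admissible over `V₀`), (ii) for every `Z ∈ skewSub M`,
**`w·D𝒜(0)[Z] = Dm(0)[Q′Z]`** — the multiplier of the constrained problem is `w⁻¹·Dm(0)` (**`multiplier_eq_fderiv_minAct_of_lift`**).  MECHANISM: the slice package of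
✓ `NE7SliceCriticalBranchLift` + ✓ `NE7MinimiserSectionLift` (`m = w·g(y, z⋆ y)`, `g = 𝒜∘Θ`), the first-order envelope formula `Dm(0) = w·Dg(0)∘inl` (✓ `NE7EnvelopeSecondOrder`),
`Q′(DΘ(0)(y′,0)) = y′` (differentiating `levelQ(chart θ_Σ p) = p.1`), and (i).
Cell `pub-balaban`, rung (B)+1 sub-cell t4, lineage `b2b-balaban-t4-ne7-p1` (CRUX PROVER NE7 #1 = OWNER of BINDER row NE7), generation 115.  Memo `t4/b2b-balaban-t4-ne7-p1-g115/ROAD-G115.md` §5.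
WHAT ([folklore]; 0 def, 0 sorry; `d = 4`, every `U(n)`, `L ≥ 2`).  HONEST FRAMING (page 1): composition of landed kernel theorems; (G3′) a HYPOTHESIS here (discharged by row NE7b's lifting at
every small datum, level by level); radii existential; OUR minimisers; nothing of Bałaban's asserted; NOT NE7 as a spine node, NOT NE3; spine 0∕9; finite T⁴ rung (B)+1 — NOT infinite
volume, NOT mass gap, NOT BetaPertH, NOT Clay.
-/

set_option autoImplicit false

open scoped BigOperators Matrix Matrix.Norms.L2Operator Topology
open NormedSpace Finset Set Filter Metric

namespace Summit.QuantumFields.BalabanUV.T4Continuum.NE7MinActMultiplier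

open Literature.MathematicalPhysics.QuantumFieldTheory.Balaban1983to89
open B7Prop1Explicit B7Prop2Explicit
open T4AveragingDeficitWall (IsUnitaryCfg SmallField fineAction)
open T4AveragingDeficitWallBoundary (IsPeriodicCfg)
open AveragingDeficitTorusChart (TDir chart chart_zero)
open AveragingDeficitChartCalculus (relLog relLog_self contDiffAt_fineAction_chart)
open AveragingDeficitTwoLevelPrep (skewSub skewPR)
open AveragingDeficitMultiLevelPrep (tower levelQ levelQ' levelQ_self tower_ne_zero)
open AveragingDeficitMultiLevelBridge (tower_eq)
open AveragingDeficitMultiLevelFermat (hasStrictFDerivAt_levelQ)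
open MinimalActionLevels (perWin levelAction stepWt stepWt_pos)
open MinimalActionSandwich (IsMinimiser admissible minAct)
open MinimalActionRate (sfClass)
open NE3EnergyShapes (IsUnitarySite IsPeriodicSite)
open NE7MinimalOrbitDatumContinuity (thresholds)
open NE7MinimalOrbitUniqueGeneric (minimal_orbit_unique_generic)
open BlockAverageCurrent (smallField_gaugeAct)
open NE7SliceCriticalBranchLift (slice_critical_branch_of_lift)
open NE7MinimiserSectionLift (minimiser_section_of_lift)
open NE7EnvelopeSecondOrder (envelope_second_order)
open NE7FibreStraightening (fibre_straightening)

noncomputable section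

variable {n : Type} [Fintype n] [DecidableEq n]

set_option maxHeartbeats 2400000 in
/-- **THE MULTIPLIER IS THE DERIVATIVE OF THE VALUE** (see the module docstring): under (G3′), (i) `D𝒜(0)[Z] = 0` whenever `Q′Z = 0`, (ii) `w·D𝒜(0)[Z] = Dm(0)[Q′Z]` for all `Z`. [folklore] -/
theorem multiplier_eq_fderiv_minAct_of_lift [Nonempty n] {L : ℕ} [NeZero L] (hL : 2 ≤ L) :
    ∃ ε₀ : ℝ, 0 < ε₀ ∧ ∀ ε : ℝ, 0 < ε → ε ≤ ε₀ → ∀ (N : ℕ) [NeZero N], 1 ≤ N →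
      ∃ δV : ℝ, 0 < δV ∧
        ∀ V₀ ∈ {V : Site 4 → Fin 4 → (Matrix n n ℂ)ˣ | IsUnitaryCfg V ∧ IsPeriodicCfg V (N : ℤ) ∧ SmallField V δV},
        ∀ (j : ℕ) (Us : Site 4 → Fin 4 → (Matrix n n ℂ)ˣ), IsMinimiser 4 (sfClass 4 L N ε) L N (j + 1) V₀ Us →
        (∀ s : Site 4 → (Matrix n n ℂ)ˣ, IsUnitarySite s → IsPeriodicSite s (N : ℤ) → gaugeAct s V₀ = V₀ →
            ∃ h : Site 4 → (Matrix n n ℂ)ˣ, IsUnitarySite h ∧ IsPeriodicSite h ((N * L ^ (j + 1) : ℕ) : ℤ) ∧ gaugeAct h Us = Us ∧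
              ∀ z : Site 4, h (((L : ℤ) ^ (j + 1)) • z) = s z) →
        (∀ Z : ↥(skewSub 4 n (L * tower L N j)), levelQ' L N j Us (Z : TDir 4 n (L * tower L N j)) = 0 → fderiv ℝ (fun Φ : ↥(skewSub 4 n (L * tower L N j)) => fineAction (chart (ContinuousLinearMap.id ℝ (Matrix n n ℂ)) (L * tower L N j) Us (Φ : TDir 4 n (L * tower L N j))) (perWin 4 (N * L ^ (j + 1)))) 0 Z = 0) ∧
        ∀ Z : ↥(skewSub 4 n (L * tower L N j)),
          ((stepWt 4 L)⁻¹) ^ (j + 1) * fderiv ℝ (fun Φ : ↥(skewSub 4 n (L * tower L N j)) => fineAction (chart (ContinuousLinearMap.id ℝ (Matrix n n ℂ)) (L * tower L N j) Us (Φ : TDir 4 n (L * tower L N j))) (perWin 4 (N * L ^ (j + 1)))) 0 Z = fderiv ℝ (fun y : ↥(skewSub 4 n N) => minAct 4 (sfClass 4 L N ε) L N (j + 1) (chart (ContinuousLinearMap.id ℝ (Matrix n n ℂ)) N V₀ (y : TDir 4 n N))) 0 (levelQ' L N j Us (Z : TDir 4 n (L * tower L N j))) := by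
  have hL1 : 1 ≤ L := by omega
  obtain ⟨ε₁, hε₁, H⟩ := thresholds (n := n) hL
  obtain ⟨ε₃, hε₃, H3⟩ := minimal_orbit_unique_generic (n := n) hL
  obtain ⟨ε₅, hε₅, H5⟩ := slice_critical_branch_of_lift (n := n) hL
  obtain ⟨ε₆, hε₆, H6⟩ := minimiser_section_of_lift (n := n) hL
  refine ⟨min ε₁ (min ε₃ (min ε₅ ε₆)), lt_min hε₁ (lt_min hε₃ (lt_min hε₅ hε₆)), fun ε hε hεle N _ hN => ?_⟩
  obtain ⟨-, -, hls, H1⟩ := H ε hε (hεle.trans (min_le_left _ _))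
  obtain ⟨δ₁, hδ₁, hint₁⟩ := H1 N hN
  obtain ⟨δ₃, hδ₃, huniq⟩ := H3 ε hε (hεle.trans ((min_le_right _ _).trans (min_le_left _ _))) N hN
  have hS5 := H5 ε hε (hεle.trans ((min_le_right _ _).trans ((min_le_right _ _).trans (min_le_left _ _)))) N hN
  obtain ⟨δ₆, hδ₆, hsec⟩ := H6 ε hε (hεle.trans ((min_le_right _ _).trans ((min_le_right _ _).trans (min_le_right _ _)))) N hN
  refine ⟨min δ₁ (min δ₃ δ₆), lt_min hδ₁ (lt_min hδ₃ hδ₆), fun V₀ hV₀ j Us hUs hlift => ?_⟩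
  obtain ⟨hV₀u, hV₀P, hV₀δ⟩ := hV₀
  have hV₀1 : V₀ ∈ {V : Site 4 → Fin 4 → (Matrix n n ℂ)ˣ | IsUnitaryCfg V ∧ IsPeriodicCfg V (N : ℤ) ∧ SmallField V δ₁} :=
    ⟨hV₀u, hV₀P, MinimalActionRate.SmallField.mono hV₀δ (min_le_left _ _)⟩
  have hV₀3 : V₀ ∈ {V : Site 4 → Fin 4 → (Matrix n n ℂ)ˣ | IsUnitaryCfg V ∧ IsPeriodicCfg V (N : ℤ) ∧ SmallField V δ₃} :=
    ⟨hV₀u, hV₀P, MinimalActionRate.SmallField.mono hV₀δ ((min_le_right _ _).trans (min_le_left _ _))⟩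
  have hV₀6 : V₀ ∈ {V : Site 4 → Fin 4 → (Matrix n n ℂ)ˣ | IsUnitaryCfg V ∧ IsPeriodicCfg V (N : ℤ) ∧ SmallField V δ₆} :=
    ⟨hV₀u, hV₀P, MinimalActionRate.SmallField.mono hV₀δ ((min_le_right _ _).trans (min_le_right _ _))⟩
  -- interiority of `U♯` (via the orbit of an interior minimiser)
  obtain ⟨U₀, hU₀, a, ha0, haε, hU₀a⟩ := hint₁ V₀ hV₀1 (j + 1)
  obtain ⟨Ur, -, horbit⟩ := huniq V₀ hV₀3 (j + 1)
  obtain ⟨u₁, hu₁, -, hg₁⟩ := horbit U₀ hU₀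
  obtain ⟨u₂, hu₂, -, hg₂⟩ := horbit Us hUs
  have hUsa : SmallField Us a := by
    have h1 : SmallField Ur a := by rw [← hg₁]; exact smallField_gaugeAct hu₁ hU₀a
    have h2 : gaugeAct (fun z => (u₂ z)⁻¹) Ur = Us := by rw [← hg₂, AveragingDeficitKDatum.gaugeAct_inv_gaugeAct]
    rw [← h2]; exact smallField_gaugeAct (fun z => (unitaryUnits _).inv_mem (hu₂ z)) h1
  haveI : NeZero (L * tower L N j) := ⟨Nat.mul_ne_zero (NeZero.ne L) (tower_ne_zero L N j)⟩
  -- (S5) the slice package and the critical branch; (S6) the branch is a section of minimisers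
  obtain ⟨Sl, ξ, σ, θS, KT, iK, πT, zs, hSlle, hξc, hσc, hξ0, hσ0, hprop, hright, hθSc, hθS0, hfibS, hiK, -, hπTsec, hKp, hgc, hzsc, hzs0, hcoer, hzscrit, hzsuniq⟩ :=
    hS5 V₀ j Us hV₀u hV₀P hUs a ha0 haε hUsa hlift
  have hkey := hsec V₀ hV₀6 j Us hUs hlift Sl ξ σ θS KT iK πT zs hξc hσc hξ0 hσ0 hprop hright hfibS hiK hπTsec hKp hzsuniq
  haveI : CompleteSpace ↥Sl := FiniteDimensional.complete ℝ _
  haveI : CompleteSpace ↥KT := FiniteDimensional.complete ℝ _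
  haveI : CompleteSpace ↥(skewSub 4 n (L * tower L N j)) := FiniteDimensional.complete ℝ _
  haveI : CompleteSpace ↥(skewSub 4 n N) := FiniteDimensional.complete ℝ _
  set W := perWin 4 (N * L ^ (j + 1)) with hW
  set w : ℝ := ((stepWt 4 L)⁻¹) ^ (j + 1) with hw
  have hw0 : 0 < w := pow_pos (inv_pos.mpr (stepWt_pos (d := 4) L hL1)) _
  have hlev : ∀ Z : Site 4 → Fin 4 → (Matrix n n ℂ)ˣ, levelAction 4 L N (j + 1) Z = w * fineAction Z W := fun Z => by rw [hw, hW]; rfl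
  have hUsU : IsUnitaryCfg Us := hUs.mem.1.1
  have eP : ((N * L ^ (j + 1) : ℕ) : ℤ) = (L : ℤ) * (tower L N j : ℕ) := by rw [tower_eq]; push_cast; ring
  have hUsP' : IsPeriodicCfg Us ((L : ℤ) * (tower L N j : ℕ)) := by rw [← eP]; exact hUs.mem.1.2.1
  set x₀ : ℝ := ε / ((L : ℝ) ^ (j + 1)) ^ 2 with hx₀
  have hx₀0 : 0 < x₀ := by positivity
  have hUsx : SmallField Us x₀ := hUs.mem.1.2.2
  -- the objects `𝒜`, `m`, `g = 𝒜 ∘ Θ`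
  set A : ↥(skewSub 4 n (L * tower L N j)) → ℝ := fun Φ => fineAction (chart (ContinuousLinearMap.id ℝ (Matrix n n ℂ)) (L * tower L N j) Us (Φ : TDir 4 n (L * tower L N j))) W with hA
  set m : ↥(skewSub 4 n N) → ℝ := fun y => minAct 4 (sfClass 4 L N ε) L N (j + 1) (chart (ContinuousLinearMap.id ℝ (Matrix n n ℂ)) N V₀ (y : TDir 4 n N)) with hm
  set g : ↥(skewSub 4 n N) × ↥KT → ℝ := fun p : ↥(skewSub 4 n N) × ↥KT =>
    fineAction (chart (ContinuousLinearMap.id ℝ (Matrix n n ℂ)) (L * tower L N j) Us ((θS (p.1, iK p.2) : ↥Sl) : TDir 4 n (L * tower L N j))) W with hg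
  have hAc : ContDiffAt ℝ 2 A 0 := by
    have h1 : ContDiffAt ℝ 2 (fun Φ : TDir 4 n (L * tower L N j) => fineAction (chart (ContinuousLinearMap.id ℝ (Matrix n n ℂ)) (L * tower L N j) Us Φ) W) ((skewSub 4 n (L * tower L N j)).subtypeL 0) := by
      rw [map_zero]; exact contDiffAt_fineAction_chart (m := 2) (ContinuousLinearMap.id ℝ (Matrix n n ℂ)) (L * tower L N j) Us W 0
    exact h1.comp 0 (skewSub 4 n (L * tower L N j)).subtypeL.contDiff.contDiffAt
  set inclSl : ↥Sl →L[ℝ] ↥(skewSub 4 n (L * tower L N j)) := LinearMap.toContinuousLinearMap (Submodule.inclusion hSlle) with hinclSl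
  set ι : ↥(skewSub 4 n N) × ↥KT →L[ℝ] ↥(skewSub 4 n N) × ↥Sl := (ContinuousLinearMap.id ℝ ↥(skewSub 4 n N)).prodMap iK with hι
  set Θ : ↥(skewSub 4 n N) × ↥KT → ↥(skewSub 4 n (L * tower L N j)) := fun p => inclSl (θS (ι p)) with hΘ
  have hιp : ∀ p : ↥(skewSub 4 n N) × ↥KT, ι p = (p.1, iK p.2) := fun p => rfl
  have hΘval : ∀ p : ↥(skewSub 4 n N) × ↥KT, ((Θ p : ↥(skewSub 4 n (L * tower L N j))) : TDir 4 n (L * tower L N j)) = ((θS (p.1, iK p.2) : ↥Sl) : TDir 4 n (L * tower L N j)) := fun p => rfl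
  have hgΘ : g = fun p => A (Θ p) := by
    funext p
    show _ = fineAction (chart (ContinuousLinearMap.id ℝ (Matrix n n ℂ)) (L * tower L N j) Us ((Θ p : ↥(skewSub 4 n (L * tower L N j))) : TDir 4 n (L * tower L N j))) W
    rw [hΘval p]
  have hΘ0 : Θ 0 = 0 := by simp only [hΘ, map_zero, hθS0]
  have hΘd : HasFDerivAt Θ (inclSl.comp ((fderiv ℝ θS 0).comp ι)) 0 := by
    have h1 : HasFDerivAt θS (fderiv ℝ θS 0) (ι 0) := by rw [map_zero]; exact (hθSc.differentiableAt (by simp)).hasFDerivAt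
    exact inclSl.hasFDerivAt.comp 0 (h1.comp 0 ι.hasFDerivAt)
  have hgd : fderiv ℝ g 0 = (fderiv ℝ A 0).comp (fderiv ℝ Θ 0) := by
    have h1 : ∀ q : ↥(skewSub 4 n (L * tower L N j)), q = 0 → HasFDerivAt A (fderiv ℝ A 0) q := fun q hq => by
      rw [hq]; exact (hAc.differentiableAt (by simp)).hasFDerivAt
    have h2 : HasFDerivAt (fun p : ↥(skewSub 4 n N) × ↥KT => A (Θ p)) ((fderiv ℝ A 0).comp (fderiv ℝ Θ 0)) 0 :=
      (h1 _ hΘ0).comp 0 hΘd.differentiableAt.hasFDerivAt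
    rw [hgΘ]; exact h2.fderiv
  -- the minimal action through the reduced action: `m = w·g(y, z⋆ y)` near `0`, `Dm(0) = w·Dg(0)∘inl`
  have hmw : m =ᶠ[𝓝 0] fun y : ↥(skewSub 4 n N) => w * g (y, zs y) := hkey.mono fun y hy => by
    show minAct 4 (sfClass 4 L N ε) L N (j + 1) _ = _
    rw [hy.minAct_eq, hlev]
  have hcrit : ∀ᶠ y : ↥(skewSub 4 n N) in 𝓝 0, fderiv ℝ (fun z : ↥KT => g (y, z)) (zs y) = 0 := hzscrit
  obtain ⟨h1, -, -, -⟩ := envelope_second_order hgc hzsc hzs0 hcrit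
  have hDm : ∀ y' : ↥(skewSub 4 n N), fderiv ℝ m 0 y' = w * fderiv ℝ A 0 (fderiv ℝ Θ 0 (y', (0 : ↥KT))) := fun y' => by
    have h0 := h1.self_of_nhds
    rw [hzs0, Prod.mk_zero_zero] at h0
    rw [((h0.const_mul w).congr_of_eventuallyEq hmw).fderiv, hgd]
    simp only [smul_apply, ContinuousLinearMap.comp_apply, ContinuousLinearMap.inl_apply, smul_eq_mul]
  -- the linearised averaging map and `Q′(DΘ(0)(y′, 0)) = y′`
  have hG : HasStrictFDerivAt (fun Φ : TDir 4 n (L * tower L N j) => levelQ L N j Us (chart (ContinuousLinearMap.id ℝ (Matrix n n ℂ)) (L * tower L N j) Us Φ)) (levelQ' L N j Us) 0 :=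
    hasStrictFDerivAt_levelQ (d := 4) hL1 j hUsU hUsP' hx₀0.le (hls j) hUsx
  have hfib1 : ∀ᶠ p : ↥(skewSub 4 n N) × ↥Sl in 𝓝 0,
      levelQ L N j Us (chart (ContinuousLinearMap.id ℝ (Matrix n n ℂ)) (L * tower L N j) Us ((θS p : ↥Sl) : TDir 4 n (L * tower L N j))) = p.1 := hfibS.mono fun p hp => hp.1
  have hQΘ : ∀ y' : ↥(skewSub 4 n N), levelQ' L N j Us ((fderiv ℝ Θ 0 (y', (0 : ↥KT)) : ↥(skewSub 4 n (L * tower L N j))) : TDir 4 n (L * tower L N j)) = y' := fun y' => by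
    have hΘd' : HasFDerivAt (fun p : ↥(skewSub 4 n N) × ↥Sl => ((θS p : ↥Sl) : TDir 4 n (L * tower L N j))) (Sl.subtypeL.comp (fderiv ℝ θS 0)) 0 :=
      Sl.subtypeL.hasFDerivAt.comp 0 (hθSc.differentiableAt (by simp)).hasFDerivAt
    have hΘ0' : (fun p : ↥(skewSub 4 n N) × ↥Sl => ((θS p : ↥Sl) : TDir 4 n (L * tower L N j))) 0 = 0 := by simp only [hθS0, Submodule.coe_zero]
    have hG' : HasFDerivAt (fun Φ : TDir 4 n (L * tower L N j) => levelQ L N j Us (chart (ContinuousLinearMap.id ℝ (Matrix n n ℂ)) (L * tower L N j) Us Φ)) (levelQ' L N j Us)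
        ((fun p : ↥(skewSub 4 n N) × ↥Sl => ((θS p : ↥Sl) : TDir 4 n (L * tower L N j))) 0) := by rw [hΘ0']; exact hG.hasFDerivAt
    have hF := hG'.comp 0 hΘd'
    have hF' : HasFDerivAt (fun p : ↥(skewSub 4 n N) × ↥Sl => levelQ L N j Us (chart (ContinuousLinearMap.id ℝ (Matrix n n ℂ)) (L * tower L N j) Us ((θS p : ↥Sl) : TDir 4 n (L * tower L N j))))
        (ContinuousLinearMap.fst ℝ ↥(skewSub 4 n N) ↥Sl) 0 :=
      (hasFDerivAt_fst (𝕜 := ℝ) (p := (0 : ↥(skewSub 4 n N) × ↥Sl))).congr_of_eventuallyEq (hfib1.mono fun p hp => hp)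
    have h := congrArg (fun T : ↥(skewSub 4 n N) × ↥Sl →L[ℝ] ↥(skewSub 4 n N) => T (y', iK 0)) (hF.unique hF')
    simp only [ContinuousLinearMap.comp_apply, Submodule.subtypeL_apply, ContinuousLinearMap.coe_fst'] at h
    rw [hΘd.fderiv]
    simp only [ContinuousLinearMap.comp_apply, hιp, hinclSl, LinearMap.coe_toContinuousLinearMap', Submodule.coe_inclusion]
    exact h
  -- (i) tangent-criticality along the fibre, via the fibre straightening `θ`
  obtain ⟨θ, -, ρ₀, -, hρ₀, hθ0, hθc, -, hθid, hθfib⟩ :=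
    fibre_straightening (d := 4) (n := n) hL1 hε.le (hls j) hUs.mem haε hUsa
  have hGs : HasFDerivAt (fun Φ : ↥(skewSub 4 n (L * tower L N j)) => levelQ L N j Us (chart (ContinuousLinearMap.id ℝ (Matrix n n ℂ)) (L * tower L N j) Us (Φ : TDir 4 n (L * tower L N j))))
      ((levelQ' L N j Us).comp (skewSub 4 n (L * tower L N j)).subtypeL) 0 := by
    have h1' : HasFDerivAt (fun Φ : TDir 4 n (L * tower L N j) => levelQ L N j Us (chart (ContinuousLinearMap.id ℝ (Matrix n n ℂ)) (L * tower L N j) Us Φ)) (levelQ' L N j Us)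
        ((skewSub 4 n (L * tower L N j)).subtypeL 0) := by rw [map_zero]; exact hG.hasFDerivAt
    exact h1'.comp 0 (skewSub 4 n (L * tower L N j)).subtypeL.hasFDerivAt
  have hGs0 : levelQ L N j Us (chart (ContinuousLinearMap.id ℝ (Matrix n n ℂ)) (L * tower L N j) Us (((0 : ↥(skewSub 4 n (L * tower L N j))) : TDir 4 n (L * tower L N j)))) = 0 := by
    rw [Submodule.coe_zero, chart_zero, levelQ_self]
  have hJd : HasFDerivAt (fun Φ : ↥(skewSub 4 n (L * tower L N j)) => θ (levelQ L N j Us (chart (ContinuousLinearMap.id ℝ (Matrix n n ℂ)) (L * tower L N j) Us (Φ : TDir 4 n (L * tower L N j))), Φ))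
      ((fderiv ℝ θ 0).comp (((levelQ' L N j Us).comp (skewSub 4 n (L * tower L N j)).subtypeL).prod (ContinuousLinearMap.id ℝ ↥(skewSub 4 n (L * tower L N j))))) 0 := by
    have h1' : ∀ p : ↥(skewSub 4 n N) × ↥(skewSub 4 n (L * tower L N j)), p = 0 → HasFDerivAt θ (fderiv ℝ θ 0) p := fun p hp => by
      rw [hp]; exact (hθc.differentiableAt (by simp)).hasFDerivAt
    exact (h1' _ (by simp only [hGs0, Prod.mk_zero_zero])).comp 0 (hGs.prodMk (hasFDerivAt_id (0 : ↥(skewSub 4 n (L * tower L N j)))))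
  have hJid : HasFDerivAt (fun Φ : ↥(skewSub 4 n (L * tower L N j)) => θ (levelQ L N j Us (chart (ContinuousLinearMap.id ℝ (Matrix n n ℂ)) (L * tower L N j) Us (Φ : TDir 4 n (L * tower L N j))), Φ))
      (ContinuousLinearMap.id ℝ ↥(skewSub 4 n (L * tower L N j))) 0 := by
    refine (hasFDerivAt_id (0 : ↥(skewSub 4 n (L * tower L N j)))).congr_of_eventuallyEq ?_
    filter_upwards [Metric.ball_mem_nhds (0 : ↥(skewSub 4 n (L * tower L N j))) hρ₀] with Φ hΦ
    exact hθid Φ (by rwa [mem_ball_zero_iff] at hΦ)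
  have hθ'X : ∀ X : ↥(skewSub 4 n (L * tower L N j)), fderiv ℝ θ 0 (levelQ' L N j Us (X : TDir 4 n (L * tower L N j)), X) = X := fun X => by
    have h := congrArg (fun T : ↥(skewSub 4 n (L * tower L N j)) →L[ℝ] ↥(skewSub 4 n (L * tower L N j)) => T X) (hJd.unique hJid)
    simpa only [ContinuousLinearMap.comp_apply, ContinuousLinearMap.prod_apply, Submodule.subtypeL_apply, ContinuousLinearMap.id_apply] using h
  have hV₀near : ∀ (r : Fin 4 → Fin N) (κ' : Fin 4),
      ‖(((V₀ (boxVec N r) κ')⁻¹ : (Matrix n n ℂ)ˣ) : Matrix n n ℂ) * (V₀ (boxVec N r) κ' : Matrix n n ℂ) - 1‖ ≤ 1 / 4 := fun r κ' => by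
    rw [Units.inv_mul, sub_self, norm_zero]; norm_num
  have hker : ∀ Z : ↥(skewSub 4 n (L * tower L N j)), levelQ' L N j Us (Z : TDir 4 n (L * tower L N j)) = 0 → fderiv ℝ A 0 Z = 0 := by
    intro Z hZ
    set ℓ₀ : ℝ →L[ℝ] ↥(skewSub 4 n N) × ↥(skewSub 4 n (L * tower L N j)) := ContinuousLinearMap.toSpanSingleton ℝ (((0 : ↥(skewSub 4 n N)), Z) : ↥(skewSub 4 n N) × ↥(skewSub 4 n (L * tower L N j))) with hℓ₀
    have htℓ : Tendsto (fun t : ℝ => ℓ₀ t) (𝓝 0) (𝓝 0) := by have h := ℓ₀.continuous.tendsto 0; rwa [map_zero] at h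
    have hsmallρ : ∀ᶠ t : ℝ in 𝓝 0, ‖ℓ₀ t‖ < ρ₀ :=
      htℓ.eventually (Filter.eventually_of_mem (Metric.ball_mem_nhds _ hρ₀) fun q hq => by rwa [mem_ball_zero_iff] at hq)
    have hmin : IsLocalMin (fun t : ℝ => A (θ (ℓ₀ t))) 0 := by
      filter_upwards [hsmallρ] with t ht
      have hp1 : (ℓ₀ t).1 = 0 := by simp only [hℓ₀, ContinuousLinearMap.toSpanSingleton_apply, Prod.smul_fst, smul_zero]
      have hadm : chart (ContinuousLinearMap.id ℝ (Matrix n n ℂ)) (L * tower L N j) Us ((θ (ℓ₀ t) : ↥(skewSub 4 n (L * tower L N j))) : TDir 4 n (L * tower L N j))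
          ∈ admissible (sfClass 4 L N ε) L (j + 1) V₀ :=
        (hθfib (ℓ₀ t) ht).2.2 V₀ hV₀u hV₀P hV₀near (by rw [relLog_self, map_zero, hp1])
      have hle := hUs.le _ hadm
      rw [hlev, hlev] at hle
      have h2 := le_of_mul_le_mul_left hle hw0
      show A (θ (ℓ₀ 0)) ≤ A (θ (ℓ₀ t))
      simp only [map_zero, hθ0, hA, Submodule.coe_zero, chart_zero]
      exact h2
    have hd0 : fderiv ℝ (fun t : ℝ => A (θ (ℓ₀ t))) 0 = 0 := hmin.fderiv_eq_zero
    have hθℓ : HasFDerivAt (fun t : ℝ => θ (ℓ₀ t)) ((fderiv ℝ θ 0).comp ℓ₀) 0 := by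
      have h1' : ∀ p : ↥(skewSub 4 n N) × ↥(skewSub 4 n (L * tower L N j)), p = 0 → HasFDerivAt θ (fderiv ℝ θ 0) p := fun p hp => by
        rw [hp]; exact (hθc.differentiableAt (by simp)).hasFDerivAt
      exact (h1' _ (map_zero ℓ₀)).comp 0 ℓ₀.hasFDerivAt
    have hAθℓ : HasFDerivAt (fun t : ℝ => A (θ (ℓ₀ t))) ((fderiv ℝ A 0).comp ((fderiv ℝ θ 0).comp ℓ₀)) 0 := by
      have h1' : ∀ q : ↥(skewSub 4 n (L * tower L N j)), q = 0 → HasFDerivAt A (fderiv ℝ A 0) q := fun q hq => by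
        rw [hq]; exact (hAc.differentiableAt (by simp)).hasFDerivAt
      exact (h1' _ (by simp only [map_zero, hθ0])).comp 0 hθℓ
    have h := congrArg (fun T : ℝ →L[ℝ] ℝ => T 1) (hAθℓ.fderiv.symm.trans hd0)
    simp only [ContinuousLinearMap.comp_apply, hℓ₀, ContinuousLinearMap.toSpanSingleton_apply, one_smul, zero_apply] at h
    have hZ' : fderiv ℝ θ 0 ((0 : ↥(skewSub 4 n N)), Z) = Z := by
      have h' := hθ'X Z; rwa [hZ] at h'
    rw [hZ'] at h
    exact h
  refine ⟨hker, fun Z => ?_⟩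
  -- (ii) the multiplier identity
  set v' : ↥(skewSub 4 n N) := levelQ' L N j Us (Z : TDir 4 n (L * tower L N j)) with hv'
  set Z₁ : ↥(skewSub 4 n (L * tower L N j)) := fderiv ℝ Θ 0 (v', (0 : ↥KT)) with hZ₁
  have hZ₁Q : levelQ' L N j Us ((Z - Z₁ : ↥(skewSub 4 n (L * tower L N j))) : TDir 4 n (L * tower L N j)) = 0 := by
    rw [Submodule.coe_sub, map_sub, hZ₁, hQΘ v', hv', sub_self]
  have hk := hker (Z - Z₁) hZ₁Q
  rw [map_sub, sub_eq_zero] at hk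
  show w * fderiv ℝ A 0 Z = fderiv ℝ m 0 v'
  rw [hDm v', hk]

end

end Summit.QuantumFields.BalabanUV.T4Continuum.NE7MinActMultiplier
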